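import Mathlib
import Summits.QuantumFields.YangMills.Theorems.ConvexGribovBodyContinuumLegGivenGapStubLockB
import HarnessLib

/-!
# `ContinuumLegGivenGap` (stmt-QuantumFields-15828), line `Sketch` (reshape 17-RP): `stub_lockOfRpCore`

Support file for the crux item stmt-QuantumFields-15828
(`Summit.QuantumFields.YangMills.Theses.ConvexGribovBody.ContinuumLegGivenGap`), registered stub
`stub_lockOfRpCore` of the line `Sketch` (reshape 17-RP).

**Statement.** Under `DirichletWindow.XiDiverges`, at a compact simple `(G, r)` with the crux's per-β
torus clustering above `β₀` (some admissible rate with a threshold and per-pair constants) and the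
RP core at `r` (β-FREE pair constants `C A B` at HALF of every admissible rate `M ∈ (0, 1]` at every
`β ≥ 0`, above volume thresholds depending on `β` AND on the support boxes `(Λ₁, Λ₂)` of the pair),
there are couplings `β_k → +∞`, rates `m̂_k > 0`, PAIR-FREE thresholds `S₁ k` and a factor `K > 0`
with (UNIFORM) one constant per pair for ALL `k` on the tori `S ≥ S₁ k`, `n ≤ S`, and (SHARP) no
volume-uniform clustering at rate `K m̂_k` at `β_k` beyond any threshold.

**Proof** (the one-sided diagonal absorption of the landed `stub_alongSequence`, over the countably
many box pairs, on top of the landed `stub_lock_of_twoSidedCoreAlong` packaging).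
`β_k := B + k` with `B := β₀ ∨ β₂ ∨ 0` (`β₂` from `sharp_eventually_of_xiDiverges` at rate `1`); at
each `k` an admissible `M_k ∈ (0, 1)` with `2 M_k` sharp (`exists_admissible_two_mul_sharp`), its
admissibility threshold `S₀ k` and per-pair admissibility constants; `m̂_k := M_k / 2`, `K := 4`
(`4 · M_k / 2 = 2 M_k` is sharp). Enumerate the box pairs `e : ℕ → Finset × Finset`
(`exists_surjective_nat`) and let `T k Λ₁ Λ₂` be the core threshold at `(β_k, M_k, S₀ k)`; put
`S₁ k := S₀ k ∨ ⋁_{j ≤ k} T k (e j)`. For a pair `(A, B)` in box pair `e j`: at the indices `k ≥ j`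
the core bound `C A B e^{-(M_k/2) n}` holds above `S₁ k ≥ T k (e j)`; the finitely many indices
`k < j` are absorbed into the constant through the admissibility constants at those `k`
(`C'_k e^{-M_k n} ≤ (C'_k ∨ 0) e^{-(M_k/2) n}` above `S₁ k ≥ S₀ k`), so the `k`-free constant
`(C A B ∨ 0) + ∑_{k < j} (C'_k ∨ 0)` works.

No definitions, no facts; Mathlib + landed tree lemmas only. [folklore]
-/

noncomputable section

namespace Summit.QuantumFields.YangMills.Theorems.ContinuumLegGivenGap

open Filter Topology
open Literature.MathematicalPhysics.QuantumFieldTheory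
open Literature.MathematicalPhysics.QuantumLattice
open Summit.QuantumFields.YangMills.Theses

/-- **`stub_lockOfRpCore`** (registered stub of stmt-QuantumFields-15828, line `Sketch`, reshape
17-RP) — **the locked IR datum from the RP core**: under `XiDiverges`, at a compact simple `(G, r)`
with the crux's per-β torus clustering above `β₀` and the RP core at `r` (β-free pair constants, half
rate, β- and box-dependent thresholds), there are `β_k → ∞`, rates `m̂_k > 0`, PAIR-FREE thresholds
`S₁ k`, and `K > 0` with (UNIFORM) one constant per pair for ALL `k` on the tori `S ≥ S₁ k`, `n ≤ S`,
and (SHARP) no volume-uniform clustering at rate `K m̂_k` at `β_k`. Route: `β_k := (β₀ ∨ β₂ ∨ 0) + k`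
(`β₂` from `sharp_eventually_of_xiDiverges` at rate `1`); at each `k` an admissible `M_k ∈ (0,1)`
with `2M_k` sharp (`exists_admissible_two_mul_sharp`), `m̂_k := M_k/2`, `K := 4`; enumerate the
countably many box pairs `e : ℕ → Finset × Finset` (`exists_surjective_nat`), `S₁ k :=` the max of
the admissibility threshold at `k` and the core thresholds at `k` of the box pairs `e j`, `j ≤ k`; for
a pair in box pair `e j` the finitely many indices `k < j` are absorbed into the constant through the
admissibility constants at those `k` — the one-sided diagonal argument of the landed
`stub_alongSequence`. [folklore] -/
theorem stub_lockOfRpCore :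
    DirichletWindow.XiDiverges →
    ∀ (G : Type) [Group G] [TopologicalSpace G] [IsTopologicalGroup G] [CompactSpace G]
      [MeasurableSpace G] [BorelSpace G], IsCompactSimpleLieGroup G → ∀ r : LatticeRep G,
      (∃ β₀ : ℝ, ∀ β : ℝ, β₀ ≤ β → ∃ m : ℝ, 0 < m ∧ ∃ S₁ : ℕ, ∀ A B : YMSpecies G, ∃ C : ℝ,
        ∀ S n : ℕ, S₁ ≤ S → n ≤ S →
          |latticeConnectedCorr r.ρ β (2 * S + 1) A.F B.F n| ≤ C * Real.exp (-(m * n))) →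
      (∃ C : YMSpecies G → YMSpecies G → ℝ,
        ∀ (β M : ℝ) (S₀ : ℕ), 0 ≤ β → 0 < M → M ≤ 1 →
          (∀ A B : YMSpecies G, ∃ C' : ℝ, ∀ S n : ℕ, S₀ ≤ S → n ≤ S →
            |latticeConnectedCorr r.ρ β (2 * S + 1) A.F B.F n| ≤ C' * Real.exp (-(M * n))) →
          ∀ Λ₁ Λ₂ : Finset (Literature.MathematicalPhysics.QuantumLattice.ZdEdge 4), ∃ S₁ : ℕ,
            ∀ A B : YMSpecies G, A.supp = Λ₁ → B.supp = Λ₂ → ∀ S n : ℕ, S₁ ≤ S → n ≤ S →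
              |latticeConnectedCorr r.ρ β (2 * S + 1) A.F B.F n| ≤ C A B * Real.exp (-(M / 2 * n))) →
      ∃ (β : ℕ → ℝ) (mh : ℕ → ℝ) (S₁ : ℕ → ℕ) (K : ℝ), Tendsto β atTop atTop ∧ (∀ k, 0 < mh k) ∧
        0 < K ∧
        (∀ A B : YMSpecies G, ∃ C : ℝ, ∀ k S n : ℕ, S₁ k ≤ S → n ≤ S →
          |latticeConnectedCorr r.ρ (β k) (2 * S + 1) A.F B.F n| ≤ C * Real.exp (-(mh k * n))) ∧
        (∀ k S₀ : ℕ, ∃ A B : YMSpecies G, ∀ C : ℝ, ∃ S n : ℕ, S₀ ≤ S ∧ n ≤ S ∧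
          C * Real.exp (-(K * mh k * n)) <
            |latticeConnectedCorr r.ρ (β k) (2 * S + 1) A.F B.F n|) := by
  intro hXi G _ _ _ _ _ _ hG r hGap hcore
  obtain ⟨β₀, hGap⟩ := hGap
  obtain ⟨C, hcore⟩ := hcore
  -- rate `1` is sharp at every `β ≥ β₂`
  obtain ⟨β₂, hβ₂⟩ := sharp_eventually_of_xiDiverges hXi hG r 1 one_pos
  -- the base coupling `B ≥ β₀ ∨ β₂ ∨ 0`; the couplings are `B + k`
  obtain ⟨Bb, hB0, hB2, hBnn⟩ : ∃ Bb : ℝ, β₀ ≤ Bb ∧ β₂ ≤ Bb ∧ 0 ≤ Bb :=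
    ⟨max (max β₀ β₂) 0, (le_max_left _ _).trans (le_max_left _ _),
      (le_max_right _ _).trans (le_max_left _ _), le_max_right _ _⟩
  have hBk : ∀ k : ℕ, Bb ≤ Bb + k := fun k => le_add_of_nonneg_right (Nat.cast_nonneg k)
  -- at each index: an admissible rate `M_k ∈ (0, 1)` whose double is sharp
  have hsel : ∀ k : ℕ, ∃ M : ℝ, 0 < M ∧ M < 1 ∧
      (∃ S₀ : ℕ, ∀ A B : YMSpecies G, ∃ C' : ℝ, ∀ S n : ℕ, S₀ ≤ S → n ≤ S →
        |latticeConnectedCorr r.ρ (Bb + k) (2 * S + 1) A.F B.F n| ≤ C' * Real.exp (-(M * n))) ∧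
      ∀ S₀ : ℕ, ∃ A B : YMSpecies G, ∀ C' : ℝ, ∃ S n : ℕ, S₀ ≤ S ∧ n ≤ S ∧
        C' * Real.exp (-(2 * M * n)) <
          |latticeConnectedCorr r.ρ (Bb + k) (2 * S + 1) A.F B.F n| := fun k => by
    obtain ⟨m, hm, S₁, hS₁⟩ := hGap (Bb + k) (hB0.trans (hBk k))
    exact exists_admissible_two_mul_sharp r (Bb + k) hm S₁ hS₁ (hβ₂ _ (hB2.trans (hBk k)))
  choose M hM0 hM1 hMadm hMsharp using hsel
  -- the admissibility thresholds `S₀ k` and the per-pair admissibility constants `Cadm k A B`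
  choose S₀ hS₀ using hMadm
  choose Cadm hCadm using hS₀
  -- the core thresholds `T k Λ₁ Λ₂` at `(β_k, M_k, S₀ k)`
  have hTex : ∀ (k : ℕ) (Λ₁ Λ₂ : Finset (Literature.MathematicalPhysics.QuantumLattice.ZdEdge 4)),
      ∃ S₁ : ℕ, ∀ A B : YMSpecies G, A.supp = Λ₁ → B.supp = Λ₂ → ∀ S n : ℕ, S₁ ≤ S → n ≤ S →
        |latticeConnectedCorr r.ρ (Bb + k) (2 * S + 1) A.F B.F n| ≤
          C A B * Real.exp (-(M k / 2 * n)) := fun k Λ₁ Λ₂ =>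
    hcore (Bb + k) (M k) (S₀ k) (hBnn.trans (hBk k)) (hM0 k) (hM1 k).le
      (fun A B => ⟨Cadm k A B, hCadm k A B⟩) Λ₁ Λ₂
  choose T hT using hTex
  -- enumerate the countably many support-box pairs
  obtain ⟨e, he⟩ := exists_surjective_nat
    (Finset (Literature.MathematicalPhysics.QuantumLattice.ZdEdge 4) ×
      Finset (Literature.MathematicalPhysics.QuantumLattice.ZdEdge 4))
  -- UNIFORM with the pair-free thresholds `S₁ k := S₀ k ∨ ⋁_{j ≤ k} T k (e j)` at rates `M_k / 2`
  have hunif : ∀ A B : YMSpecies G, ∃ C₁ : ℝ, ∀ k S n : ℕ,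
      max (S₀ k) ((Finset.range (k + 1)).sup fun j => T k (e j).1 (e j).2) ≤ S → n ≤ S →
        |latticeConnectedCorr r.ρ (Bb + k) (2 * S + 1) A.F B.F n| ≤
          C₁ * Real.exp (-(M k / 2 * n)) := by
    intro A B
    obtain ⟨j, hj⟩ := he (A.supp, B.supp)
    have hj1 : A.supp = (e j).1 := by rw [hj]
    have hj2 : B.supp = (e j).2 := by rw [hj]
    refine ⟨max (C A B) 0 + ∑ k ∈ Finset.range j, max (Cadm k A B) 0, fun k S n hS hn => ?_⟩
    have hsum0 : 0 ≤ ∑ k' ∈ Finset.range j, max (Cadm k' A B) 0 :=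
      Finset.sum_nonneg fun k' _ => le_max_right _ _
    have hexp0 : 0 ≤ Real.exp (-(M k / 2 * n)) := (Real.exp_pos _).le
    rcases le_or_gt j k with hjk | hkj
    · -- `j ≤ k`: the core threshold of the box pair `e j` at index `k` is below `S₁ k`
      have hTS : T k (e j).1 (e j).2 ≤ S :=
        le_trans (le_trans (Finset.le_sup (f := fun j' => T k (e j').1 (e j').2)
          (Finset.mem_range.2 (Nat.lt_succ_of_le hjk))) (le_max_right _ _)) hS
      calc |latticeConnectedCorr r.ρ (Bb + k) (2 * S + 1) A.F B.F n|
          ≤ C A B * Real.exp (-(M k / 2 * n)) := hT k _ _ A B hj1 hj2 S n hTS hn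
        _ ≤ (max (C A B) 0 + ∑ k' ∈ Finset.range j, max (Cadm k' A B) 0) *
              Real.exp (-(M k / 2 * n)) :=
            mul_le_mul_of_nonneg_right ((le_max_left _ _).trans (le_add_of_nonneg_right hsum0))
              hexp0
    · -- `k < j`: absorbed into the constant through the admissibility constant at `k`
      have hS0 : S₀ k ≤ S := le_trans (le_max_left _ _) hS
      have hrate : Real.exp (-(M k * n)) ≤ Real.exp (-(M k / 2 * n)) :=
        Real.exp_le_exp.2 (neg_le_neg (mul_le_mul_of_nonneg_right (half_le_self (hM0 k).le)
          (Nat.cast_nonneg n)))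
      have hle : max (Cadm k A B) 0 ≤
          max (C A B) 0 + ∑ k' ∈ Finset.range j, max (Cadm k' A B) 0 :=
        le_trans (Finset.single_le_sum (f := fun k' => max (Cadm k' A B) 0)
          (fun k' _ => le_max_right _ _) (Finset.mem_range.2 hkj))
          (le_add_of_nonneg_left (le_max_right _ _))
      calc |latticeConnectedCorr r.ρ (Bb + k) (2 * S + 1) A.F B.F n|
          ≤ Cadm k A B * Real.exp (-(M k * n)) := hCadm k A B S n hS0 hn
        _ ≤ max (Cadm k A B) 0 * Real.exp (-(M k / 2 * n)) :=
            (mul_le_mul_of_nonneg_right (le_max_left _ _) (Real.exp_pos _).le).trans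
              (mul_le_mul_of_nonneg_left hrate (le_max_right _ _))
        _ ≤ (max (C A B) 0 + ∑ k' ∈ Finset.range j, max (Cadm k' A B) 0) *
              Real.exp (-(M k / 2 * n)) := mul_le_mul_of_nonneg_right hle hexp0
  -- SHARP at rate `4 · (M_k / 2) = 2 M_k`
  have hsharp : ∀ k S' : ℕ, ∃ A B : YMSpecies G, ∀ C' : ℝ, ∃ S n : ℕ, S' ≤ S ∧ n ≤ S ∧
      C' * Real.exp (-(4 * (M k / 2) * n)) <
        |latticeConnectedCorr r.ρ (Bb + k) (2 * S + 1) A.F B.F n| := fun k S' => by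
    have h : (4 : ℝ) * (M k / 2) = 2 * M k := by ring
    rw [h]
    exact hMsharp k S'
  exact ⟨fun k => Bb + k, fun k => M k / 2,
    fun k => max (S₀ k) ((Finset.range (k + 1)).sup fun j => T k (e j).1 (e j).2), 4,
    tendsto_atTop_add_const_left _ _ tendsto_natCast_atTop_atTop, fun k => half_pos (hM0 k),
    four_pos, hunif, hsharp⟩

end Summit.QuantumFields.YangMills.Theorems.ContinuumLegGivenGap

end
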